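import Literature.MathematicalPhysics.QuantumLattice.AbelianFieldTensor
import HarnessLib

/-!
# Magnetic flux through the coordinate planes of the periodic lattice and its quantisation

Continuation of `AbelianFieldTensor.lean` (Lüscher's abelian field tensor `F_{μν} = (1/i) ln P`):
the **magnetic flux** of a `U(1)` lattice gauge field on the periodic lattice `Γ = (ℤ/Lℤ)^d`
through the `(μ,ν)`-plane through `x`,

  `φ_{μν}(x) = Σ_{s,t=0}^{L−1} F_{μν}(x + sμ̂ + tν̂)`   [Luscher1999AbelianChiral, §2.2 (2.10)],

is an integer multiple of `2π` (2.11): the product of the plaquette variables over a coordinate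
plane of the torus is `1`, because every link of the plane occurs once with each orientation
(`prod_prod_plaquetteHolonomy_plane`, any abelian gauge group), hence `exp(iφ) = 1`
(`exp_magneticFlux`, `exists_int_magneticFlux_eq`). For Lüscher's flux-sector field `V_{[m]}`
(constant field tensor `2π m_{μν}/L²`, `abelianFieldTensor_fluxSectorField`) the flux is
`φ_{μν} = 2π m_{μν}` (`magneticFlux_fluxSectorField`), identifying the integer tensor `m` of
`IOSFluxSectorIndex` (`AbelianFluxSectors.lean`) with the magnetic flux quantum numbers of §2.2.

Not here: the `x`-independence of the flux quantum `m_{μν}` for admissible fields (second half of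
(2.11)), which rests on the lattice Bianchi identity for `|F_{μν}| < π/3`
(`-- TODO(general form): magneticFlux U x μ ν = magneticFlux U y μ ν for admissible U`).

## References

* M. Lüscher, *Abelian chiral gauge theories on the lattice with exact gauge invariance*,
  Nucl. Phys. B 549 (1999) 295–334, arXiv:hep-lat/9811032, §2.2 eqs. (2.10)–(2.11), §7.2.
  [Luscher1999AbelianChiral]
-/

noncomputable section

open Finset
open Literature.Probability.LatticeModels (TorusSite)
open Literature.MathematicalPhysics.QuantumFieldTheory

namespace Literature.MathematicalPhysics.QuantumLattice

/-! ### Magnetic flux through the coordinate planes and its quantisation -/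

section Flux

variable {d L : ℕ} [NeZero L]

/-- `Circle.exp` of a finite sum is the product of the exponentials. [folklore] -/
theorem circleExp_finset_sum {ι : Type*} (s : Finset ι) (f : ι → ℝ) :
    Circle.exp (∑ i ∈ s, f i) = ∏ i ∈ s, Circle.exp (f i) := by
  classical
  induction s using Finset.induction_on with
  | empty => simp
  | insert a s ha ih => rw [Finset.sum_insert ha, Finset.prod_insert ha, Circle.exp_add, ih]

omit [NeZero L] in
/-- Shifting the plane point `x + s μ̂ + t ν̂` by `μ̂`. [folklore] -/
theorem plane_shift_mu (x : TorusSite d L) (μ ν : Fin d) (s t : ZMod L) :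
    Site.shift (x + Pi.single μ s + Pi.single ν t) μ = x + Pi.single μ (s + 1) + Pi.single ν t := by
  rw [Site.shift, Pi.single_add]
  abel

omit [NeZero L] in
/-- Shifting the plane point `x + s μ̂ + t ν̂` by `ν̂`. [folklore] -/
theorem plane_shift_nu (x : TorusSite d L) (μ ν : Fin d) (s t : ZMod L) :
    Site.shift (x + Pi.single μ s + Pi.single ν t) ν = x + Pi.single μ s + Pi.single ν (t + 1) := by
  rw [Site.shift, Pi.single_add]
  abel

/-- **The product of the plaquettes over a coordinate plane of the torus is trivial** (abelian
gauge group): every link of the plane occurs once with each orientation. This is the identity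
behind the quantisation of the magnetic flux, Lüscher NPB 549 §2.2. [cite: Luscher1999AbelianChiral, §2.2 (2.10)–(2.11)] -/
theorem prod_prod_plaquetteHolonomy_plane {G : Type*} [CommGroup G] (U : GaugeConfig d L G)
    (x : TorusSite d L) (μ ν : Fin d) :
    ∏ s : ZMod L, ∏ t : ZMod L, plaquetteHolonomy U (x + Pi.single μ s + Pi.single ν t) μ ν = 1 := by
  simp only [plaquetteHolonomy, plane_shift_mu, plane_shift_nu, Finset.prod_mul_distrib,
    Finset.prod_inv_distrib]
  -- reindex `s ↦ s + 1` in the second factor and `t ↦ t + 1` in the third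
  have h2 : ∏ s : ZMod L, ∏ t : ZMod L, U (x + Pi.single μ (s + 1) + Pi.single ν t, ν) =
      ∏ s : ZMod L, ∏ t : ZMod L, U (x + Pi.single μ s + Pi.single ν t, ν) :=
    Fintype.prod_equiv (Equiv.addRight (1 : ZMod L)) _ _ fun s => by
      simp only [Equiv.coe_addRight]
  have h3 : ∏ s : ZMod L, ∏ t : ZMod L, U (x + Pi.single μ s + Pi.single ν (t + 1), μ) =
      ∏ s : ZMod L, ∏ t : ZMod L, U (x + Pi.single μ s + Pi.single ν t, μ) :=
    Finset.prod_congr rfl fun s _ =>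
      Fintype.prod_equiv (Equiv.addRight (1 : ZMod L)) _ _ fun t => by
        simp only [Equiv.coe_addRight]
  rw [h2, h3, mul_inv_cancel_comm, mul_inv_cancel]

/-- **Magnetic flux** through the `(μ,ν)`-plane through `x`:
`φ_{μν}(x) = Σ_{s,t=0}^{L−1} F_{μν}(x + sμ̂ + tν̂)`. [cite: Luscher1999AbelianChiral, §2.2, eq. (2.10)] -/
def magneticFlux (U : GaugeConfig d L Circle) (x : TorusSite d L) (μ ν : Fin d) : ℝ :=
  ∑ s : ZMod L, ∑ t : ZMod L, abelianFieldTensor U (x + Pi.single μ s + Pi.single ν t) μ ν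

/-- `exp(i φ_{μν}(x)) = Π_plane P = 1`. [cite: Luscher1999AbelianChiral, §2.2] -/
theorem exp_magneticFlux (U : GaugeConfig d L Circle) (x : TorusSite d L) (μ ν : Fin d) :
    Circle.exp (magneticFlux U x μ ν) = 1 := by
  rw [magneticFlux, circleExp_finset_sum]
  simp_rw [circleExp_finset_sum, exp_abelianFieldTensor]
  exact prod_prod_plaquetteHolonomy_plane U x μ ν

/-- **Flux quantisation**: the magnetic flux through every coordinate plane of the periodic
lattice is an integer multiple of `2π`, `φ_{μν}(x) = 2π m` — the first half of Lüscher's (2.11)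
(the independence of `m_{μν}` of `x` for admissible fields, which rests on the lattice Bianchi
identity under `|F| < π/3`, is not proved here). [cite: Luscher1999AbelianChiral, §2.2, eq. (2.11)] -/
theorem exists_int_magneticFlux_eq (U : GaugeConfig d L Circle) (x : TorusSite d L) (μ ν : Fin d) :
    ∃ m : ℤ, magneticFlux U x μ ν = 2 * Real.pi * m := by
  obtain ⟨n, hn⟩ := Circle.exp_eq_one.mp (exp_magneticFlux U x μ ν)
  exact ⟨n, by rw [hn]; ring⟩

/-- **The flux-sector field `V_{[m]}` has flux `2π m_{μν}` through every `(μ,ν)`-plane**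
(`L²` plaquettes of constant field tensor `2π m_{μν}/L²`). [cite: Luscher1999AbelianChiral, §7.2] -/
theorem magneticFlux_fluxSectorField (m : Fin 4 → Fin 4 → ℤ) (hm : ∀ μ ν, m ν μ = -m μ ν)
    (x : TorusSite 4 L) (μ ν : Fin 4) (hb : 2 * |(m μ ν : ℝ)| < (L : ℝ) ^ 2) :
    magneticFlux (fluxSectorField L m) x μ ν = 2 * Real.pi * (m μ ν : ℝ) := by
  simp only [magneticFlux, abelianFieldTensor_fluxSectorField m hm _ μ ν hb, Finset.sum_const,
    Finset.card_univ, ZMod.card, nsmul_eq_mul]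
  have hL : (L : ℝ) ≠ 0 := Nat.cast_ne_zero.mpr (NeZero.ne L)
  field_simp

end Flux

end Literature.MathematicalPhysics.QuantumLattice
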